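import Literature.NumberTheory.Rogawski1990.ArchExplicitTransferFactorRegular  -- ★ `isUnit_archGammaTwo`, `archHeckeValue_ne_zero_of_isUnit`; ★ `ArchExplicitTransferFactor` (`archHeckeValue`, `archTau`, `archWeylRatio`)
import Literature.NumberTheory.Automorphic.IdeleClassGroupUnitMaps            -- ★ `continuous_infiniteIdeles`
import Literature.NumberTheory.Automorphic.AdelicGLnGlue                      -- ★ `continuous_ringEquiv_mixedSpace_symm`
import HarnessLib

/-!
# `μ_∞` is continuous at the units of `L ⊗ ℝ`; Rogawski's archimedean `τ(γ_H) = μ_∞(u) μ_∞(−χ_g(u)∕det g)⁻¹` is continuous where `χ_g(u)` is a unit, and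
# `D_{G∕H,∞}(γ_H) = Π_w |χ_g(u)_w|` everywhere (Rogawski (1990) §4.9 p. 55; Tate (1967) §4.3)

Topic `NumberTheory/Rogawski1990`; namespace `Literature.NumberTheory.Rogawski1990`.  THEOREMS ONLY (no definition, no named fact, no instance, no notation,
no `sorry`; net debt 0).  Cell `pub/hodgecm-mathlib`, F0∕P3a, topic T6 (#88 side): part A (the `τ · D` half) of the archimedean companion of ★
`FinExplicitTransferFactorLocallyConstant` (node D-G4 of `SIZING-S1prime` §2∕§7 at `v = ∞`, row (κ-arch)); part B is `ArchExplicitTransferFactorLocallyConstant`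
(the signs `κ_w` and the head).  Mathlib-only footing; count-neutral for the books.

THE MATHEMATICS.  `L ⊗ ℝ = ℝ^{r₁} × ℂ^{r₂}` (Mathlib `mixedEmbedding.mixedSpace L`): a point is a unit iff all its coordinates are non-zero, so the units form an
OPEN set and inversion is continuous on them, whence the unit group carries the SUBSPACE topology (Mathlib `Units.embedding_val_mk`).  On the units ★
`archHeckeValue μ` («`μ_∞`», typ-T6b N1a) is `μ ∘ infiniteIdeles ∘ (L_∞ ≃ L ⊗ ℝ)⁻¹` restricted to the unit group — a composite of continuous maps (★
`continuous_infiniteIdeles`, ★ `continuous_ringEquiv_mixedSpace_symm`, Mathlib `Continuous.units_map`, the Hecke character's continuity) — so `μ_∞` is continuous at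
every unit (`continuousAt_archHeckeValue`, through the generic `continuousAt_of_eq_apply_unit_of_isEmbedding`).  `u = γ₂`, `χ_g(u) = u² − tr(g)u + det g`
(Mathlib `charpoly_fin_two`) and `−χ_g(u)·det g⁻¹` are continuous in `γ_H ∈ H_∞ = U(Φ₂)(L⁺⊗ℝ) × U(Φ₁)(L⁺⊗ℝ)` (a closed subgroup of `GL₂ × GL₁ (L ⊗ ℝ)`), both
arguments of `μ_∞` in `τ` are units where `χ_g(u)` is (★ `isUnit_archGammaTwo`, `isUnit_archTauArg_of_isUnit`) and `μ_∞ ≠ 0` there (★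
`archHeckeValue_ne_zero_of_isUnit`): `τ` is continuous on `{χ_g(u) ∈ (L⊗ℝ)^×}`; `D_{G∕H,∞}` is a finite product of norms of continuous functions (★ `continuous_evalC`).

* §1 `isOpen_setOf_isUnit_mixedSpace`, `continuousOn_inv_setOf_isUnit_mixedSpace`, `isEmbedding_units_val_mixedSpace`,
  `continuousAt_of_eq_apply_unit_of_isEmbedding` (generic), **`continuousAt_archHeckeValue`**; `continuous_fst_archGroupMatrix`, `continuous_archGammaTwo`,
  `continuous_eval_archCharpolyTwo`, `continuous_archTauArg`, `isUnit_archTauArg_of_isUnit`, **`continuousOn_archTau`**, **`continuous_archWeylRatio`**.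

HONEST LABEL: HC_CM is proved only modulo the printed citations (named inputs remaining 2) until rung 0 closes; this file proves none of them.

## References
* [Rogawski1990] J. D. Rogawski, *Automorphic Representations of Unitary Groups in Three Variables*, Ann. of Math. Stud. 123 (1990): §4.9 p. 55 (`τ`, `D_{G∕H}`),
  §14.6 p. 242 (`Δ″_∞`).
* [TateThesis1967] J. Tate, *Fourier analysis in number fields and Hecke's zeta-functions* (1950∕1967), §4.3 (archimedean components of idèle-class characters).
-/

set_option autoImplicit false

noncomputable section

open NumberField InfinitePlace IsDedekindDomain Matrix Polynomial Filter Topology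
open scoped MatrixGroups ComplexConjugate

namespace Literature.NumberTheory.Rogawski1990

open Literature.NumberTheory.Automorphic
open Literature.NumberTheory.GaloisRepresentations

/-! ## §1 `μ_∞` at units; continuity of `u`, `χ_g(u)`, `τ`, `D_{G∕H,∞}` -/

section Units

variable (L : Type) [Field L] [NumberField L]

/-- **The units of `L ⊗ ℝ = ℝ^{r₁} × ℂ^{r₂}` form an open set** (a unit is a point with all coordinates non-zero). [cite: TateThesis1967, §4.3] -/
theorem isOpen_setOf_isUnit_mixedSpace : IsOpen {x : mixedEmbedding.mixedSpace L | IsUnit x} := by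
  have hset : {x : mixedEmbedding.mixedSpace L | IsUnit x} =
      (⋂ v : {w : InfinitePlace L // IsReal w}, (fun x : mixedEmbedding.mixedSpace L => x.1 v) ⁻¹' {0}ᶜ) ∩
        ⋂ w : {w : InfinitePlace L // IsComplex w}, (fun x : mixedEmbedding.mixedSpace L => x.2 w) ⁻¹' {0}ᶜ := by
    ext x
    simp only [Set.mem_setOf_eq, Prod.isUnit_iff, Pi.isUnit_iff, isUnit_iff_ne_zero, Set.mem_inter_iff, Set.mem_iInter,
      Set.mem_preimage, Set.mem_compl_iff, Set.mem_singleton_iff]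
  rw [hset]
  exact (isOpen_iInter_of_finite fun v => isOpen_compl_singleton.preimage ((continuous_apply v).comp continuous_fst)).inter
    (isOpen_iInter_of_finite fun w => isOpen_compl_singleton.preimage ((continuous_apply w).comp continuous_snd))

omit [NumberField L] in
/-- Inversion is continuous on the units of `L ⊗ ℝ` (componentwise `continuousAt_inv₀`). [cite: TateThesis1967, §4.3] -/
theorem continuousOn_inv_setOf_isUnit_mixedSpace :
    ContinuousOn (fun x : mixedEmbedding.mixedSpace L => x⁻¹) {x : mixedEmbedding.mixedSpace L | IsUnit x} := by
  intro x hx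
  refine ContinuousAt.continuousWithinAt ?_
  rw [Set.mem_setOf_eq, Prod.isUnit_iff, Pi.isUnit_iff, Pi.isUnit_iff] at hx
  have h1 : ContinuousAt (fun y : mixedEmbedding.mixedSpace L => (y⁻¹).1) x := by
    refine continuousAt_pi.2 fun v => ?_
    have h : (fun y : mixedEmbedding.mixedSpace L => (y⁻¹).1 v) = fun y => (y.1 v)⁻¹ := rfl
    rw [h]
    exact ContinuousAt.comp (g := fun t : ℝ => t⁻¹) (f := fun y : mixedEmbedding.mixedSpace L => y.1 v) (x := x)
      (continuousAt_inv₀ (hx.1 v).ne_zero) ((continuous_apply v).comp continuous_fst).continuousAt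
  have h2 : ContinuousAt (fun y : mixedEmbedding.mixedSpace L => (y⁻¹).2) x := by
    refine continuousAt_pi.2 fun w => ?_
    have h : (fun y : mixedEmbedding.mixedSpace L => (y⁻¹).2 w) = fun y => (y.2 w)⁻¹ := rfl
    rw [h]
    exact ContinuousAt.comp (g := fun t : ℂ => t⁻¹) (f := fun y : mixedEmbedding.mixedSpace L => y.2 w) (x := x)
      (continuousAt_inv₀ (hx.2 w).ne_zero) ((continuous_apply w).comp continuous_snd).continuousAt
  exact h1.prodMk h2

omit [NumberField L] in
/-- **The unit group of `L ⊗ ℝ` carries the subspace topology** (`Units.val` is an embedding). [cite: TateThesis1967, §4.3] -/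
theorem isEmbedding_units_val_mixedSpace : IsEmbedding (Units.val : (mixedEmbedding.mixedSpace L)ˣ → mixedEmbedding.mixedSpace L) :=
  Units.embedding_val_mk (continuousOn_inv_setOf_isUnit_mixedSpace L)

/-- **Continuity at units of a function read through an open, embedded unit group** (generic): if `{x | IsUnit x}` is open, `Units.val` is an
embedding, and `f y = g (y as a unit)` at units for a continuous `g`, then `f` is continuous at every unit. [cite: TateThesis1967, §4.3] -/
theorem continuousAt_of_eq_apply_unit_of_isEmbedding {M X : Type*} [Monoid M] [TopologicalSpace M] [TopologicalSpace X]
    (hopen : IsOpen {x : M | IsUnit x}) (hemb : IsEmbedding (Units.val : Mˣ → M)) {g : Mˣ → X} (hg : Continuous g)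
    {f : M → X} (hf : ∀ (y : M) (hy : IsUnit y), f y = g hy.unit) {x : M} (hx : IsUnit x) : ContinuousAt f x := by
  classical
  have hU : {y : M | IsUnit y} ∈ 𝓝 x := hopen.mem_nhds hx
  set lift : M → Mˣ := fun y => if h : IsUnit y then h.unit else 1 with hlift_def
  have hlift : ContinuousOn lift {y : M | IsUnit y} := by
    rw [hemb.continuousOn_iff]
    refine continuousOn_id.congr fun y hy => ?_
    rw [Set.mem_setOf_eq] at hy
    simp only [Function.comp_apply, hlift_def, dif_pos hy, IsUnit.unit_spec, id]
  have hf' : ContinuousOn f {y : M | IsUnit y} := by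
    refine (hg.comp_continuousOn hlift).congr fun y hy => ?_
    rw [Set.mem_setOf_eq] at hy
    simp only [Function.comp_apply, hlift_def, dif_pos hy, hf y hy]
  exact hf'.continuousAt hU

/-- **`μ_∞` is continuous at every unit of `L ⊗ ℝ`** — there ★ `archHeckeValue μ` is `μ ∘ infiniteIdeles ∘ (L_∞ ≃ L ⊗ ℝ)⁻¹` on the embedded unit group
(★ `continuous_infiniteIdeles`, ★ `continuous_ringEquiv_mixedSpace_symm`). [cite: Rogawski1990, §4.9 p. 55] [cite: TateThesis1967, §4.3] -/
theorem continuousAt_archHeckeValue (μ : HeckeCharacter L) {x : mixedEmbedding.mixedSpace L} (hx : IsUnit x) :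
    ContinuousAt (archHeckeValue L μ) x := by
  refine continuousAt_of_eq_apply_unit_of_isEmbedding (isOpen_setOf_isUnit_mixedSpace L) (isEmbedding_units_val_mixedSpace L)
    (g := fun u : (mixedEmbedding.mixedSpace L)ˣ =>
      ((μ (infiniteIdeles L (Units.map ((InfiniteAdeleRing.ringEquiv_mixedSpace L).symm :
        mixedEmbedding.mixedSpace L ≃+* InfiniteAdeleRing L).toMonoidHom u)) : ℂˣ) : ℂ))
    ?_ (fun y hy => ?_) hx
  · refine Units.continuous_val.comp (μ.toContinuousMonoidHom.continuous.comp ((continuous_infiniteIdeles L).comp ?_))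
    exact Continuous.units_map _ (continuous_ringEquiv_mixedSpace_symm L)
  · classical
    unfold archHeckeValue
    rw [dif_pos hy]

end Units

section TauWeyl

variable (L : Type) [Field L] [NumberField L] [IsCMField L]

/-- `γ_H ↦ g` (the `U(Φ₂)`-block as a matrix over `L ⊗ ℝ`) is continuous. [cite: Rogawski1990, §4.9 p. 55] -/
theorem continuous_fst_archGroupMatrix :
    Continuous fun a : ↥(UnitaryGroup.arch (↥(maximalRealSubfield L)) L (IsCMField.complexConj L) 2
          (Matrix.of fun i j : Fin 2 => if i.val + j.val + 1 = 2 then (1 : L) else 0)) ×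
        ↥(UnitaryGroup.arch (↥(maximalRealSubfield L)) L (IsCMField.complexConj L) 1
          (Matrix.of fun i j : Fin 1 => if i.val + j.val + 1 = 1 then (1 : L) else 0)) =>
      ((a.1 : GL (Fin 2) (mixedEmbedding.mixedSpace L)) : Matrix (Fin 2) (Fin 2) (mixedEmbedding.mixedSpace L)) :=
  Units.continuous_val.comp (continuous_subtype_val.comp continuous_fst)

/-- **`u = γ₂` is continuous in `γ_H`.** [cite: Rogawski1990, §4.9 p. 55] -/
theorem continuous_archGammaTwo :
    Continuous fun a : ↥(UnitaryGroup.arch (↥(maximalRealSubfield L)) L (IsCMField.complexConj L) 2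
          (Matrix.of fun i j : Fin 2 => if i.val + j.val + 1 = 2 then (1 : L) else 0)) ×
        ↥(UnitaryGroup.arch (↥(maximalRealSubfield L)) L (IsCMField.complexConj L) 1
          (Matrix.of fun i j : Fin 1 => if i.val + j.val + 1 = 1 then (1 : L) else 0)) => archGammaTwo L a := by
  have h1 : Continuous fun a : ↥(UnitaryGroup.arch (↥(maximalRealSubfield L)) L (IsCMField.complexConj L) 2
          (Matrix.of fun i j : Fin 2 => if i.val + j.val + 1 = 2 then (1 : L) else 0)) ×
        ↥(UnitaryGroup.arch (↥(maximalRealSubfield L)) L (IsCMField.complexConj L) 1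
          (Matrix.of fun i j : Fin 1 => if i.val + j.val + 1 = 1 then (1 : L) else 0)) =>
      ((a.2 : GL (Fin 1) (mixedEmbedding.mixedSpace L)) : Matrix (Fin 1) (Fin 1) (mixedEmbedding.mixedSpace L)) :=
    Units.continuous_val.comp (continuous_subtype_val.comp continuous_snd)
  unfold archGammaTwo
  exact (continuous_apply 0).comp ((continuous_apply 0).comp h1)

/-- **`χ_g(u) = u² − tr(g) u + det g` is continuous in `γ_H`** (Mathlib `charpoly_fin_two`). [cite: Rogawski1990, §4.9 p. 55] -/
theorem continuous_eval_archCharpolyTwo :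
    Continuous fun a : ↥(UnitaryGroup.arch (↥(maximalRealSubfield L)) L (IsCMField.complexConj L) 2
          (Matrix.of fun i j : Fin 2 => if i.val + j.val + 1 = 2 then (1 : L) else 0)) ×
        ↥(UnitaryGroup.arch (↥(maximalRealSubfield L)) L (IsCMField.complexConj L) 1
          (Matrix.of fun i j : Fin 1 => if i.val + j.val + 1 = 1 then (1 : L) else 0)) =>
      (archCharpolyTwo L a).eval (archGammaTwo L a) := by
  have hexp : ∀ a : ↥(UnitaryGroup.arch (↥(maximalRealSubfield L)) L (IsCMField.complexConj L) 2
          (Matrix.of fun i j : Fin 2 => if i.val + j.val + 1 = 2 then (1 : L) else 0)) ×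
        ↥(UnitaryGroup.arch (↥(maximalRealSubfield L)) L (IsCMField.complexConj L) 1
          (Matrix.of fun i j : Fin 1 => if i.val + j.val + 1 = 1 then (1 : L) else 0)),
      (archCharpolyTwo L a).eval (archGammaTwo L a) =
        archGammaTwo L a * archGammaTwo L a -
          ((a.1 : GL (Fin 2) (mixedEmbedding.mixedSpace L)) : Matrix (Fin 2) (Fin 2) (mixedEmbedding.mixedSpace L)).trace * archGammaTwo L a +
          ((a.1 : GL (Fin 2) (mixedEmbedding.mixedSpace L)) : Matrix (Fin 2) (Fin 2) (mixedEmbedding.mixedSpace L)).det := fun a => by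
    rw [archCharpolyTwo, Matrix.charpoly_fin_two]
    simp only [eval_add, eval_sub, eval_mul, eval_pow, eval_X, eval_C]
    ring
  simp_rw [hexp]
  have hg := continuous_fst_archGroupMatrix L
  have hu := continuous_archGammaTwo L
  exact ((hu.mul hu).sub (hg.matrix_trace.mul hu)).add hg.matrix_det

/-- **`−χ_g(u) · det g⁻¹` is continuous in `γ_H`.** [cite: Rogawski1990, §4.9 p. 55] -/
theorem continuous_archTauArg :
    Continuous fun a : ↥(UnitaryGroup.arch (↥(maximalRealSubfield L)) L (IsCMField.complexConj L) 2
          (Matrix.of fun i j : Fin 2 => if i.val + j.val + 1 = 2 then (1 : L) else 0)) ×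
        ↥(UnitaryGroup.arch (↥(maximalRealSubfield L)) L (IsCMField.complexConj L) 1
          (Matrix.of fun i j : Fin 1 => if i.val + j.val + 1 = 1 then (1 : L) else 0)) => archTauArg L a := by
  have hinv : Continuous fun a : ↥(UnitaryGroup.arch (↥(maximalRealSubfield L)) L (IsCMField.complexConj L) 2
          (Matrix.of fun i j : Fin 2 => if i.val + j.val + 1 = 2 then (1 : L) else 0)) ×
        ↥(UnitaryGroup.arch (↥(maximalRealSubfield L)) L (IsCMField.complexConj L) 1
          (Matrix.of fun i j : Fin 1 => if i.val + j.val + 1 = 1 then (1 : L) else 0)) =>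
      (((a.1 : GL (Fin 2) (mixedEmbedding.mixedSpace L))⁻¹ : GL (Fin 2) (mixedEmbedding.mixedSpace L)) :
        Matrix (Fin 2) (Fin 2) (mixedEmbedding.mixedSpace L)) :=
    Units.continuous_coe_inv.comp (continuous_subtype_val.comp continuous_fst)
  unfold archTauArg
  exact (continuous_eval_archCharpolyTwo L).neg.mul hinv.matrix_det

/-- **`−χ_g(u)·det g⁻¹` is a unit when `χ_g(u)` is** (no `G`-regularity). [cite: Rogawski1990, §4.9 p. 55] -/
theorem isUnit_archTauArg_of_isUnit
    (a : ↥(UnitaryGroup.arch (↥(maximalRealSubfield L)) L (IsCMField.complexConj L) 2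
          (Matrix.of fun i j : Fin 2 => if i.val + j.val + 1 = 2 then (1 : L) else 0)) ×
        ↥(UnitaryGroup.arch (↥(maximalRealSubfield L)) L (IsCMField.complexConj L) 1
          (Matrix.of fun i j : Fin 1 => if i.val + j.val + 1 = 1 then (1 : L) else 0)))
    (hu : IsUnit ((archCharpolyTwo L a).eval (archGammaTwo L a))) : IsUnit (archTauArg L a) := by
  unfold archTauArg
  exact hu.neg.mul (Matrix.isUnits_det_units _)

/-- **`τ(γ_H) = μ_∞(u) · μ_∞(−χ_g(u)∕det g)⁻¹` IS CONTINUOUS ON `{χ_g(u) ∈ (L ⊗ ℝ)^×}`** (both arguments of `μ_∞` are units there: ★ `isUnit_archGammaTwo`,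
`isUnit_archTauArg_of_isUnit`; `μ_∞ ≠ 0` at units, ★ `archHeckeValue_ne_zero_of_isUnit`). [cite: Rogawski1990, §4.9 p. 55] -/
theorem continuousOn_archTau (μ : HeckeCharacter L) :
    ContinuousOn
      (fun a : ↥(UnitaryGroup.arch (↥(maximalRealSubfield L)) L (IsCMField.complexConj L) 2
          (Matrix.of fun i j : Fin 2 => if i.val + j.val + 1 = 2 then (1 : L) else 0)) ×
        ↥(UnitaryGroup.arch (↥(maximalRealSubfield L)) L (IsCMField.complexConj L) 1
          (Matrix.of fun i j : Fin 1 => if i.val + j.val + 1 = 1 then (1 : L) else 0)) => archTau L a μ)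
      {a | IsUnit ((archCharpolyTwo L a).eval (archGammaTwo L a))} := by
  intro a ha
  rw [Set.mem_setOf_eq] at ha
  refine ContinuousAt.continuousWithinAt ?_
  unfold archTau
  have h1 := (continuousAt_archHeckeValue L μ (isUnit_archGammaTwo L a)).comp (continuous_archGammaTwo L).continuousAt
  have h2 := (continuousAt_archHeckeValue L μ (isUnit_archTauArg_of_isUnit L a ha)).comp (continuous_archTauArg L).continuousAt
  exact h1.mul (h2.inv₀ (archHeckeValue_ne_zero_of_isUnit L μ (isUnit_archTauArg_of_isUnit L a ha)))

open scoped Classical in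
/-- **`D_{G∕H,∞}(γ_H) = Π_w |χ_g(u)_w|` IS CONTINUOUS** in `γ_H` (★ `continuous_evalC`). [cite: Rogawski1990, §4.9 p. 55] -/
theorem continuous_archWeylRatio :
    Continuous fun a : ↥(UnitaryGroup.arch (↥(maximalRealSubfield L)) L (IsCMField.complexConj L) 2
          (Matrix.of fun i j : Fin 2 => if i.val + j.val + 1 = 2 then (1 : L) else 0)) ×
        ↥(UnitaryGroup.arch (↥(maximalRealSubfield L)) L (IsCMField.complexConj L) 1
          (Matrix.of fun i j : Fin 1 => if i.val + j.val + 1 = 1 then (1 : L) else 0)) => archWeylRatio L a := by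
  unfold archWeylRatio
  refine continuous_finsetProd _ fun w _ => ?_
  exact continuous_norm.comp ((UnitaryGroup.continuous_evalC L w).comp (continuous_eval_archCharpolyTwo L))

end TauWeyl

end Literature.NumberTheory.Rogawski1990

end
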